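import Summits.BirchSwinnertonDyer.Rank1Residual.Additive.X3BranchAlgebraicCountWMult
import Summits.BirchSwinnertonDyer.Rank1Residual.Additive.X3BranchAlgebraicCountW
import Summits.BirchSwinnertonDyer.Rank1Residual.AdditivePotMult.NonPrimitiveMuTransferOdd
import Summits.BirchSwinnertonDyer.Rank1Residual.X2.NonPrimitiveSelmerTorsionCard
import Literature.NumberTheory.EllipticCurves.GreenbergVatsal2000.DatumSelmerDivisibleRamifiedQuotient
import HarnessLib

/-!
# X3 on the semistable-twist locus, the DEGENERATE rows at `p = 3` (`E[3]^{ss} = {1, ω}`): Greenberg–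
# Vatsal's residual count for `Sel_{p^∞}(E/ℚ_∞)` at the TRIVIAL line — `#H¹(ℚ_Σ/ℚ_∞, Φ₀)·#U(E[p]/Φ₀)
# = p^{λ(X(E/ℚ_∞)) + Σ_{ℓ∈Σ₀} δ_ℓ(E) + 1}` — from PUBLISHED records, the "+1" being the rational
# `p`-torsion point (cell `bsd-eis`, seat `bsd-eis-x3` gen 2; x3-MEMO-2 D1–D4 / x3-MEMO-3 §1–§2 in the
# kernel; route K1 `AdditiveBranchIMC`, crux `GordTwoRankZeroOffCaseOne` — supports only)

HONEST FRAMING (cell `bsd-eis`, `run/shared/lean/pub/bsd-eis/README.md` §4): the programme's target of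
record is the full Birch–Swinnerton-Dyer formula for every `E/ℚ` of analytic rank `≤ 1`; this file
concerns the X3 rows (`E = W` additive at the odd `p`, `E[p]` REDUCIBLE) of the semistable-twist locus
(`W = C • V^{(p*)}`, `V` good ordinary or multiplicative at `p`) whose rational `p`-line `Φ₀ ≤ W[p]`
carries the TRIVIAL character — `W(ℚ)[p] ≠ 0` with the rational point of order `p` ON the ramified
ordinary line of the twisted Greenberg datum (GV's "case 1" member of the class; at `p = 3`:
`W[3]^{ss} = {1, ω}`, the DEGENERATE rows of x3-MEMO-1 R3 — 121 of the 155 X3 ∩ (e = 2) census pairs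
at `3` with `N ≤ 3000`, 8 901 classes of bsd-addord's branch-parity census). THEOREMS ONLY (no
`def`, no named fact, no `sorry`); nothing is booked; no label, tier or count of record moves.
Every non-datum hypothesis is a PUBLISHED record of the tree: `h23` (GV 2000 Cor. (2.3)/Prop. (2.4)
at the datum), `hRQ` (GV 2000 Prop. (2.5) via Remark (2.7) ¶2 with the proof of Prop. (2.8):
`datumSelmer_divisible_of_finite_torsionBy_of_gr_inertiaInvariants_eq_zero`, landed by cell
`bsd-addord` — referee directive REF-VERDICT-x3-MEMO-3 §2: IMPORT it, do not file (I4′)), and the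
residual lifting `hlift` (for the data-generic theorem displayed; = the reading-fact
`residualEpsilon_surjOn_of_lineEven`, whose printed proof (GV p. 30) uses only the evenness of the
line — the trivial line IS even). ONE input is displayed and NOT in the tree: `hA`, the finiteness of
`E(ℚ_∞)[p^∞]` (GV p. 26 "`E(ℚ_∞)_tors` is known to be finite": Imai 1975 / Ribet 1981; the tree
proves it only where `E(ℚ_∞)[p^∞] = E(ℚ)[p^∞]`, which FAILS here: `ℤ/3 → ℤ/9` growth over the first
layer occurs on these rows, planner FINDING F3).

## What and why

bsd-addord's datum-generic count `natCard_line_mul_quotSelmer_eq_of_data_of_lifting`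
(`X3BranchAlgebraicCountWMult.lean` §1: GV (16)+(11) for `Sel_{p^∞}(W/ℚ_∞)`) needs a rational line
with NON-TRIVIAL `Γ_ℚ`-action: it uses `p ∤ #W(ℚ)_tors` three times — (a) finiteness of
`W(ℚ_∞)[p^∞]` for the record `h23`, (b) Greenberg's Prop. 4.14 (`h414`: no finite `Λ`-submodule),
(c) the correction factor `#W(ℚ_∞)[p] = 1` in GV's Prop. (2.8) comparison
`#S^{Σ₀}_{W[p]} = #(S^{Σ₀}_{W[p^∞]} ⊓ H¹[p])·#W(ℚ_∞)[p]`. On the degenerate rows (x3-MEMO-3 §1–§2):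
(a) ↦ the displayed `hA`; (b) ↦ GV Remark (2.7) ¶2 (`hRQ`, hypothesis `D^{I_η} = 0` = the tree's
`data_gr_invariants_eq_zero_of_isRamifiedOrdinaryLine`): `S^{Σ₀}_A(ℚ_∞)` is `p`-DIVISIBLE at `μ = 0`,
whence `#Sel^{Σ₀}[p] = p^{λ(X^{Σ₀})}` (X2's `finite_and_natCard_torsionBy_eq_pow_lambdaInvariant_of_divisible`);
(c) ↦ **`#W(ℚ_∞)[p^∞][p] = p`** (§1: `W(ℚ_∞)[p^∞] ⊂ C` because `(A/C)^{I_η} = 0`, and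
`C ∩ W[p] = Φ₀` has order `p`, all of it rational) — the "+1" of x3-MEMO-2 D1.

* §1 TOOLS: `mem_plus_of_forall_inertia_smul_sub_mem` (GV Remark (2.9)'s `D^{I_η} = 0` in the
  membership form of `hRQ`), `mem_plus_of_mem_fixedPoints` (`W(ℚ_∞)[p^∞] ⊂ C`),
  `natCard_torsionBy_fixedPoints_eq_of_trivialLine` (`#W(ℚ_∞)[p] = p`),
  `record_consequences_of_finite` (bsd-addord's `record_consequences_of_eq` with the finiteness of
  `W(ℚ_∞)[p^∞]` displayed instead of `p ∤ #W(ℚ)_tors`).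
* §2 **`natCard_line_mul_quotSelmer_eq_of_data_of_lifting_of_trivialLine`** — DATUM-GENERIC degenerate
  count: `#H¹(ℚ_Σ/ℚ_∞, Φ₀)·#U = p^{λ(D.X) + Σδ + 1}` for every TORSION dual datum `D` with `μ = 0`,
  Greenberg data of ramified ordinary lines with the R-D identity and `p`-torsion plus-part `Φ₀`,
  `Φ₀` with TRIVIAL `Γ_ℚ`-action, `Σ₀ ∌ p` NONEMPTY with the bad places `≠ p` inside.
* SEQUEL `X3BranchDegenerateCountCells.lean`: the two cells ((G-ord, `e = 2`) from
  `exists_data_isRamifiedOrdinaryLine_plus_eq_lineSub` + `hGrK`; (M) from the Tate data + `hT40`/`hT41`)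
  in the `λ(g)` currency of the certificate road (`X3BranchCertificateRoad.lean`), the ramified
  `χ_K`-twist of the trivial line, and `hLamW` from the count + the displayed EVALUATION
  `hn : p^{n + Σδ + 1} = #H¹·#U` (x3-MEMO-3 (ALG-deg′): `λ_alg = Σ_ℓ s_ℓ t_ℓ(E) − 2`).

## What this is NOT

Not the EVALUATION of `#H¹(ℚ_Σ/ℚ_∞, 𝔽_p)` (`= p^{Σ_{ℓ∈Σ₀, ℓ ≡ 1 (p)} s_ℓ}`) and `#U(μ_p)`
(`= p^{Σ_{ℓ∈Σ₀} s_ℓ − 1}`) — class-field theory over `ℚ_∞` for the trivial and Teichmüller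
characters, exactly the two cases GV p. 29 excludes ("assuming ξ nontrivial", "assume ξ ≠ ω"); it
stays the displayed `hn` of the certificate road (per pair an instrument datum). Not a proof of `hA`
(Imai/Ribet; not in the tree). Not a class theorem, not the analytic side (no congruence with unit
constant term is in print on these rows: the per-pair unit-coefficient certificate replaces it), not
rank `1`, not the other member of the isogeny class (`μ_3`-line member: `λ` is isogeny-invariant,
GV p. 28 — not transported here).

References: [GreenbergVatsal2000] §2 Prop. (2.1), Cor. (2.3), Prop. (2.4), (2.5), Remark (2.7),
Prop. (2.8), Remark (2.9), pp. 16–30; [GreenbergLNM1716] §1 p. 62, §3 p. 86 (finiteness of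
`E(ℚ_∞)_tors`: Imai, Ribet), Props. 2.2/2.4; [SilvermanATAEC1994] V.5.3/5.4; cell files
`run/shared/lean/pub/bsd-eis/x3-MEMO-2.md` §2 D1–D4, `x3-MEMO-3.md` §1–§2, `REF-VERDICT-x3-MEMO-3.md`.
-/

set_option autoImplicit false

noncomputable section

open scoped Classical AddSubgroup

namespace Summit.BirchSwinnertonDyer.Rank1Residual.Additive

open NumberField IsDedekindDomain Field WeierstrassCurve
  Literature.NumberTheory.GaloisRepresentations
  Literature.NumberTheory.EllipticCurves
  Literature.NumberTheory.EllipticCurves.GreenbergSelmer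
  Literature.NumberTheory.EllipticCurves.GreenbergVatsal2000
  Literature.NumberTheory.EllipticCurves.EmertonPollackWeston2006
  Literature.NumberTheory.EllipticCurves.Rank1Residual
  Summit.BirchSwinnertonDyer.Rank1Residual.X2
  Summit.BirchSwinnertonDyer.Rank1Residual.X2.GreenbergVatsalTorsion
  Summit.BirchSwinnertonDyer.Rank1Residual.X2.GreenbergVatsalReductionDatum
  Summit.BirchSwinnertonDyer.Rank1Residual.X2.ResidualDevissageLine
  Summit.BirchSwinnertonDyer.Rank1Residual.X2.NonPrimitiveSelmerDual
  Summit.BirchSwinnertonDyer.Rank1Residual.X1.MuLambda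
  Summit.BirchSwinnertonDyer.Rank1Residual.GaloisImage.RamifiedOrdinaryLineTwist
  Summit.BirchSwinnertonDyer.Rank1Residual.AdditivePotMult
  Summit.BirchSwinnertonDyer.Rank1Residual.AdditivePotMult.RamifiedOrdinaryLinePotMult
  Summit.BirchSwinnertonDyer.Rank1Residual.Additive.TameDescent

/-! ### §1 Tools: `W(ℚ_∞)[p^∞] ⊂ C`, `#W(ℚ_∞)[p] = p`, the record with displayed finiteness -/

section Tools

variable {p : ℕ} [hp : Fact p.Prime] {W : WeierstrassCurve ℚ} [W.IsElliptic]
  {κ : ZpExtension ℚ p}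

omit [W.IsElliptic] in
/-- **GV Remark (2.9)'s `(A/C)^{I_η} = 0` in membership form**: if every `(ker κ ⊓ I_v)`-invariant of
`A/C` vanishes (`h0`, the tree's `data_gr_invariants_eq_zero_of_isRamifiedOrdinaryLine` shape) then an
`m ∈ A` with `x • m − m ∈ C` for all `x ∈ I_v ⊓ ker κ` lies in `C` (the hypothesis shape `_hD` of the
reading-fact `datumSelmer_divisible_of_finite_torsionBy_of_gr_inertiaInvariants_eq_zero`).
[cite: GreenbergVatsal2000, §2 Remark (2.7) pp. 24–25 and Remark (2.9) p. 25] -/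
theorem mem_plus_of_forall_inertia_smul_sub_mem {v : HeightOneSpectrum (𝓞 ℚ)}
    (L : LocalDatum ℚ (W.geomPrimaryTorsion p) v)
    (h0 : ∀ a ∈ X2.TorsionComparison.invariants (inertiaIn κ.kerSubgroup v) L.Gr, a = 0)
    (m : W.geomPrimaryTorsion p)
    (hm : ∀ x ∈ inertia v ⊓ κ.kerSubgroup, x • m - m ∈ L.plus) : m ∈ L.plus := by
  have ha : L.grMk m ∈ X2.TorsionComparison.invariants (inertiaIn κ.kerSubgroup v) L.Gr := by
    rw [X2.TorsionComparison.mem_invariants_iff]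
    intro xI
    obtain ⟨hκx, hIx⟩ := (mem_inertiaIn_iff κ.kerSubgroup v (xI : decomp v)).1 xI.2
    change ((xI : decomp v)) • L.grMk m = L.grMk m
    rw [LocalDatum.smul_grMk]
    have hsub := hm _ (Subgroup.mem_inf.2 ⟨hIx, hκx⟩)
    have : L.grMk (((xI : decomp v) : absoluteGaloisGroup ℚ) • m - m) = 0 := by
      rw [← L.ker_grMk] at hsub
      exact (AddMonoidHom.mem_ker).1 hsub
    rwa [map_sub, sub_eq_zero] at this
  have h := h0 _ ha
  rw [← AddMonoidHom.mem_ker, L.ker_grMk] at h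
  exact h

omit [W.IsElliptic] in
/-- **`W(ℚ_∞)[p^∞] ⊂ C`** for a Greenberg datum whose quotient has no `(ker κ ⊓ I_v)`-invariants:
a point fixed by `ker κ = Gal(ℚ̄/ℚ_∞)` is fixed by `I_v ⊓ ker κ`, so its class in `A/C` is invariant,
hence `0` (x3-MEMO-3 §1 (a): "`E(ℚ_∞)[3^∞] ⊂ F⁺A`"). [cite: GreenbergVatsal2000, §2 Remark (2.9) p. 25] -/
theorem mem_plus_of_mem_fixedPoints {v : HeightOneSpectrum (𝓞 ℚ)}
    (L : LocalDatum ℚ (W.geomPrimaryTorsion p) v)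
    (h0 : ∀ a ∈ X2.TorsionComparison.invariants (inertiaIn κ.kerSubgroup v) L.Gr, a = 0)
    {m : W.geomPrimaryTorsion p}
    (hm : m ∈ FixedPoints.addSubgroup κ.kerSubgroup (W.geomPrimaryTorsion p)) : m ∈ L.plus := by
  refine mem_plus_of_forall_inertia_smul_sub_mem L h0 m fun x hx ↦ ?_
  have hfix : x • m = m := by
    have h := (FixedPoints.mem_addSubgroup _ _ _).mp hm ⟨x, (Subgroup.mem_inf.1 hx).2⟩
    rwa [Subgroup.mk_smul] at h
  rw [hfix, sub_self]
  exact zero_mem _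

/-- **`#W(ℚ_∞)[p^∞][p] = p` on the degenerate rows** (x3-MEMO-2 D1 / x3-MEMO-3 §1): `W(ℚ_∞)[p^∞]`
lies in the ramified ordinary line `C` (previous lemma), whose `p`-torsion `C ∩ A[p]` has order `p`
(`natCard_plus_inf_torsionBy_eq`); conversely the rational line `Φ₀` — of order `p`, with TRIVIAL
`Γ_ℚ`-action — consists of `ker κ`-fixed `p`-torsion points. [cite: GreenbergVatsal2000, §2 Prop. (2.8) and Remark (2.9) p. 25] -/
theorem natCard_torsionBy_fixedPoints_eq_of_trivialLine {v : HeightOneSpectrum (𝓞 ℚ)}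
    (L : LocalDatum ℚ (W.geomPrimaryTorsion p) v) (hL : IsRamifiedOrdinaryLine W p L)
    (h0 : ∀ a ∈ X2.TorsionComparison.invariants (inertiaIn κ.kerSubgroup v) L.Gr, a = 0)
    {Φ₀ : AddSubgroup (geomTorsion W (p : ℤ))} (hΦ : IsRationalLine W p Φ₀)
    (htriv : ∀ (σ : absoluteGaloisGroup ℚ) (P : geomTorsion W (p : ℤ)), P ∈ Φ₀ → σ • P = P) :
    Nat.card ((FixedPoints.addSubgroup κ.kerSubgroup (W.geomPrimaryTorsion p))[(p : ℤ)]) = p := by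
  set F := FixedPoints.addSubgroup κ.kerSubgroup (W.geomPrimaryTorsion p) with hF
  set T := AddSubgroup.torsionBy (↥(W.geomPrimaryTorsion p)) (p : ℤ) with hT
  have hCT : Nat.card ↥(L.plus ⊓ T) = p :=
    AdditivePotMult.RamifiedLineUnique.natCard_plus_inf_torsionBy_eq hL
  haveI hfinCT : Finite ↥(L.plus ⊓ T) := Nat.finite_of_card_ne_zero (by rw [hCT]; exact hp.out.ne_zero)
  -- (i) `F[p] ↪ C ∩ A[p]`
  let f₁ : ↥((↥F)[(p : ℤ)]) → ↥(L.plus ⊓ T) := fun x ↦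
    ⟨((x : F) : W.geomPrimaryTorsion p), AddSubgroup.mem_inf.2
      ⟨mem_plus_of_mem_fixedPoints L h0 (x : F).2, AddSubgroup.torsionBy.nsmul_iff.mpr (by
        have hx : p • ((x : (↥F)[(p : ℤ)]) : ↥F) = 0 := by
          exact_mod_cast AddSubgroup.torsionBy.nsmul x
        exact_mod_cast congrArg (fun t : ↥F ↦ (t : W.geomPrimaryTorsion p)) hx)⟩⟩
  have hf₁ : Function.Injective f₁ := by
    intro x y hxy
    have h := congrArg Subtype.val hxy
    exact Subtype.ext (Subtype.ext h)
  haveI : Finite ↥((↥F)[(p : ℤ)]) := Finite.of_injective f₁ hf₁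
  have hle : Nat.card ↥((↥F)[(p : ℤ)]) ≤ p :=
    (Nat.card_le_card_of_injective f₁ hf₁).trans hCT.le
  -- (ii) `Φ₀ ↪ F[p]`
  let ι := AddSubgroup.inclusion (geomTorsion_le_geomPrimaryTorsion W p)
  have hιfix : ∀ P : ↥Φ₀, ι (P : geomTorsion W (p : ℤ)) ∈ F := by
    intro P
    rw [hF, FixedPoints.mem_addSubgroup]
    intro g
    rw [Subgroup.smul_def, ← TateLineDecomposition.inclusion_smul, htriv _ _ P.2]
  have hιtors : ∀ P : ↥Φ₀, p • ι (P : geomTorsion W (p : ℤ)) = 0 := by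
    intro P
    rw [← map_nsmul, AddSubgroup.torsionBy.nsmul (P : geomTorsion W (p : ℤ)), map_zero]
  let f₂ : ↥Φ₀ → ↥((↥F)[(p : ℤ)]) := fun P ↦
    ⟨⟨ι (P : geomTorsion W (p : ℤ)), hιfix P⟩, AddSubgroup.torsionBy.nsmul_iff.mpr
      (Subtype.ext (by rw [AddSubmonoidClass.coe_nsmul]; exact hιtors P))⟩
  have hf₂ : Function.Injective f₂ := by
    intro P Q hPQ
    have h := congrArg (fun z : ↥((↥F)[(p : ℤ)]) ↦ ((z : F) : W.geomPrimaryTorsion p)) hPQ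
    exact Subtype.ext (AddSubgroup.inclusion_injective _ h)
  have hge : p ≤ Nat.card ↥((↥F)[(p : ℤ)]) :=
    hΦ.1.symm.le.trans (Nat.card_le_card_of_injective f₂ hf₂)
  exact le_antisymm hle hge

omit [W.IsElliptic] in
/-- **The record `h23` read in CLASSICAL currency, with the finiteness of `W(ℚ_∞)[p^∞]` DISPLAYED**
(bsd-addord's `record_consequences_of_eq`, VERBATIM except that its hypothesis `p ∤ #W(ℚ)_tors` —
used there only to get `Finite W(ℚ_∞)[p^∞]` — is replaced by that finiteness itself, `hA`): GV
Cor. (2.3) + Prop. (2.4) at the datum give, for a f.g. TORSION dual datum `D` of `Sel` and ANY dual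
datum `DS` of `Sel^{Σ₀}`: `DS.X` f.g. torsion, `μ(DS.X) = μ(D.X)`, `λ(DS.X) = λ(D.X) + Σ_{v∈Σ₀} δ_v(W)`.
[cite: GreenbergVatsal2000, §2 Cor. (2.3), Prop. (2.4) (arXiv:math/9906215 pp. 20–22) and p. 26] -/
theorem record_consequences_of_finite [W.IsElliptic] [W.IsGloballyMinimal]
    {γ : absoluteGaloisGroup ℚ} (h23 : datumSelmer_nonPrimitive_invariants) (hp2 : p ≠ 2)
    (hκ : κ.IsCyclotomic) (hγ : κ.IsTopGenerator γ) (Lf : Data ℚ (W.geomPrimaryTorsion p) p)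
    (hLf : ∀ (v : HeightOneSpectrum (𝓞 ℚ)) (hv : ((p : ℕ) : 𝓞 ℚ) ∈ v.asIdeal),
      IsRamifiedOrdinaryLine W p (Lf v hv))
    (hA : Finite (FixedPoints.addSubgroup κ.kerSubgroup (W.geomPrimaryTorsion p)))
    (S₀ : Finset (HeightOneSpectrum (𝓞 ℚ)))
    (hS₀ : ∀ v ∈ S₀, ((p : ℕ) : 𝓞 ℚ) ∉ v.asIdeal)
    (hSel : W.selmerInfty κ =
      datumSelmerInfty κ (W.geomPrimaryTorsion p) Lf (∅ : Set (HeightOneSpectrum (𝓞 ℚ))))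
    (hNP : nonPrimitiveSelmerInfty W κ (↑S₀ : Set (HeightOneSpectrum (𝓞 ℚ))) =
      datumSelmerInfty κ (W.geomPrimaryTorsion p) Lf (↑S₀ : Set (HeightOneSpectrum (𝓞 ℚ))))
    (D : W.SelmerDualData κ γ) [Module.Finite (IwasawaAlgebra p) D.X] (hD : D.IsTorsion)
    (DS : NonPrimitiveDualData W κ γ (↑S₀ : Set (HeightOneSpectrum (𝓞 ℚ)))) :
    Module.Finite (IwasawaAlgebra p) DS.X ∧ Module.IsTorsion (IwasawaAlgebra p) DS.X ∧
      muInvariant p DS.X = muInvariant p D.X ∧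
      lambdaInvariant p DS.X = lambdaInvariant p D.X + ∑ v ∈ S₀, delta W p v := by
  obtain ⟨X, ⟨eX⟩⟩ := exists_datumDualData_of_selmerDualData Lf hSel D
  obtain ⟨X₀, ⟨e₀⟩⟩ := exists_datumDualData_of_nonPrimitiveDualData Lf _ hNP DS
  haveI : Module.Finite (IwasawaAlgebra p) X.X := Module.Finite.equiv eX.symm
  have hXt : Module.IsTorsion (IwasawaAlgebra p) X.X :=
    IwasawaAlgebra.isTorsion_of_injective eX.toLinearMap eX.injective hD
  have hC : ∀ (v : HeightOneSpectrum (𝓞 ℚ)) (hv : ((p : ℕ) : 𝓞 ℚ) ∈ v.asIdeal),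
      (∀ c ∈ (Lf v hv).plus, ∃ c' ∈ (Lf v hv).plus, p • c' = c) ∧
        Nat.card ↥((Lf v hv).plus ⊓ (↥(W.geomPrimaryTorsion p))[(p : ℤ)]) = p :=
    fun v hv ↦ ⟨fun c hc ↦ (hLf v hv).divisible hc,
      AdditivePotMult.RamifiedLineUnique.natCard_plus_inf_torsionBy_eq (hLf v hv)⟩
  obtain ⟨hfg, htor, hμ, hlam, -⟩ := h23 W p hp2 κ hκ γ hγ Lf hC hA S₀ hS₀ X X₀ hXt
  haveI : Module.Finite (IwasawaAlgebra p) X₀.X := hfg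
  refine ⟨Module.Finite.equiv e₀, ?_, ?_, ?_⟩
  · exact IwasawaAlgebra.isTorsion_of_injective e₀.symm.toLinearMap e₀.symm.injective htor
  · rw [← muInvariant_eq_of_linearEquiv e₀, hμ, muInvariant_eq_of_linearEquiv eX]
  · rw [← lambdaInvariant_eq_of_linearEquiv e₀, hlam, lambdaInvariant_eq_of_linearEquiv eX]

end Tools

/-! ### §2 The DEGENERATE count, DATUM-GENERIC: `#H¹(ℚ_Σ/ℚ_∞, Φ₀)·#U = p^{λ + Σδ + 1}` -/

section Generic

variable {p : ℕ} [hp : Fact p.Prime] {W : WeierstrassCurve ℚ} [W.IsElliptic] [W.IsGloballyMinimal]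

/-- **GV (16)+(11) for `Sel_{p^∞}(W/ℚ_∞)` at the TRIVIAL line, DATUM-GENERIC — the degenerate count
(x3-MEMO-2 D1–D4, x3-MEMO-3 §1–§2) in the kernel.** `W/ℚ` globally minimal, `p` odd, `κ` cyclotomic
with topological generator `γ`; Greenberg data `Lf` above `p` of RAMIFIED ORDINARY LINES with the R-D
identity over `ℚ_∞` (`hRD`) and `p`-torsion plus-part the rational line `Φ₀` (`hplus`); `Φ₀` with
TRIVIAL `Γ_ℚ`-action (`htriv` — a rational point of order `p` on the line: the degenerate member);
`Σ₀ ∌ p` finite, NONEMPTY, with the bad places `≠ p` inside; the residual lifting `hlift`;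
`W(ℚ_∞)[p^∞]` finite (`hA`, displayed); `D` ANY `Λ`-dual datum of `Sel_{p^∞}(W/ℚ_∞)` with `D.X` f.g.
TORSION and `μ = 0`. THEN `#H¹(ℚ_Σ/ℚ_∞, Φ₀)·#U(W[p]/Φ₀) = p^{λ(D.X) + Σ_{v∈Σ₀} δ_v(W) + 1}`, GRANTED
the records `h23` (GV Cor. (2.3)/Prop. (2.4) at the datum) and `hRQ` (GV Remark (2.7) ¶2: at
`μ = 0` the non-primitive datum Selmer group is DIVISIBLE when `(A/C)^{I_η} = 0`). Chain: R-D ⟹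
`Sel = S_A`, `Sel^{Σ₀} = S^{Σ₀}_A`; `h23` ⟹ `X^{Σ₀}` torsion, `μ(X^{Σ₀}) = 0`,
`λ(X^{Σ₀}) = λ(X) + Σδ`; `hRQ` (the quotient has no `(ker κ ⊓ I_v)`-invariants,
`data_gr_invariants_eq_zero_of_isRamifiedOrdinaryLine`) ⟹ `Sel^{Σ₀}` divisible ⟹
`#Sel^{Σ₀}[p] = p^{λ(X^{Σ₀})}`; GV Prop. (2.8)/Remark (2.9)
(`natCard_gvSelmer_torsion_curve_of_invariants_eq_bot_of_finite`) with the correction factor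
`#W(ℚ_∞)[p^∞][p] = p` (§1); display (16) at the datum
(`X3TwistedDatum.natCard_gvSelmer_torsion_eq_mul_of_plus_eq_line`; the trivial line is even).
[cite: GreenbergVatsal2000, §2 pp. 26–30 (display (16), (11)), Cor. (2.3), Prop. (2.4), Remark (2.7), Prop. (2.8), Remark (2.9)] -/
theorem natCard_line_mul_quotSelmer_eq_of_data_of_lifting_of_trivialLine
    (h23 : datumSelmer_nonPrimitive_invariants)
    (hRQ : datumSelmer_divisible_of_finite_torsionBy_of_gr_inertiaInvariants_eq_zero) (hp2 : p ≠ 2)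
    {κ : ZpExtension ℚ p} {γ : absoluteGaloisGroup ℚ} (hκ : κ.IsCyclotomic) (hγ : κ.IsTopGenerator γ)
    (Lf : Data ℚ (W.geomPrimaryTorsion p) p)
    (hLf : ∀ (v : HeightOneSpectrum (𝓞 ℚ)) (hv : ((p : ℕ) : 𝓞 ℚ) ∈ v.asIdeal),
      IsRamifiedOrdinaryLine W p (Lf v hv))
    (hRD : ∀ (v : HeightOneSpectrum (𝓞 ℚ)) (hv : ((p : ℕ) : 𝓞 ℚ) ∈ v.asIdeal),
      (Lf v hv).greenbergKer κ.kerSubgroup = W.localKerOver p κ.kerSubgroup (v.adicCompletion ℚ))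
    (S₀ : Finset (HeightOneSpectrum (𝓞 ℚ))) (hne : S₀.Nonempty)
    (hS₀ : ∀ v ∈ S₀, ((p : ℕ) : 𝓞 ℚ) ∉ v.asIdeal)
    (hS : ∀ v : HeightOneSpectrum (𝓞 ℚ), v ∉ S₀ → ((p : ℕ) : 𝓞 ℚ) ∉ v.asIdeal →
      W.HasGoodReductionAt v)
    {Φ₀ : AddSubgroup (W.geomTorsion (p : ℤ))} (hΦ : IsRationalLine W p Φ₀)
    (htriv : ∀ (σ : absoluteGaloisGroup ℚ) (P : geomTorsion W (p : ℤ)), P ∈ Φ₀ → σ • P = P)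
    (hA : Finite (FixedPoints.addSubgroup κ.kerSubgroup (W.geomPrimaryTorsion p)))
    (hplus : ∀ (v : HeightOneSpectrum (𝓞 ℚ)) (hv : ((p : ℕ) : 𝓞 ℚ) ∈ v.asIdeal),
      (torsionDatum (Lf v hv) p).plus = (lineSub Φ₀ hΦ).toAddSubgroup)
    (hlift : ∀ s ∈ residualQuotSelmer W p κ S₀ Φ₀ hΦ, ∃ x ∈ residualTorsionH1 W p κ S₀,
      residualEpsilon W p κ Φ₀ hΦ x = s)
    (D : W.SelmerDualData κ γ) [Module.Finite (IwasawaAlgebra p) D.X] (hDt : D.IsTorsion)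
    (hμ : D.mu = 0) :
    Nat.card (residualLineH1 W p κ S₀ Φ₀ hΦ) * Nat.card (residualQuotSelmer W p κ S₀ Φ₀ hΦ) =
      p ^ (lambdaInvariant p D.X + ∑ v ∈ S₀, delta W p v + 1) := by
  have hS₀' : ∀ v ∈ (↑S₀ : Set (HeightOneSpectrum (𝓞 ℚ))), ((p : ℕ) : 𝓞 ℚ) ∉ v.asIdeal :=
    fun v hv ↦ hS₀ v (Finset.mem_coe.mp hv)
  have hS' : ∀ v : HeightOneSpectrum (𝓞 ℚ), v ∉ (↑S₀ : Set (HeightOneSpectrum (𝓞 ℚ))) →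
      ((p : ℕ) : 𝓞 ℚ) ∉ v.asIdeal → W.HasGoodReductionAt v :=
    fun v hv hpv ↦ hS v (fun h ↦ hv (Finset.mem_coe.2 h)) hpv
  have heven : LineEven W p Φ₀ := fun c _ P hP ↦ htriv c P hP
  -- the quotient has no `(ker κ ⊓ I_v)`-invariants (GV Remark (2.9))
  have h0 := RamifiedOrdinaryLineQuotientModelFree.data_gr_invariants_eq_zero_of_isRamifiedOrdinaryLine
    hp2 κ Lf hLf
  -- `Sel = S_A`, `Sel^{Σ₀} = S^{Σ₀}_A`
  have hSel := selmerInfty_eq_datumSelmerInfty W p κ hp2 hκ Lf hRD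
  have hNP := nonPrimitiveSelmerInfty_eq_datumSelmerInfty W p κ
    (↑S₀ : Set (HeightOneSpectrum (𝓞 ℚ))) hp2 hκ Lf hRD hS₀'
  -- the record in classical currency on X2's non-primitive dual
  set DS := X2.NonPrimitiveSelmerDual.nonPrimitiveDualData W κ
    (↑S₀ : Set (HeightOneSpectrum (𝓞 ℚ))) hγ with hDS
  obtain ⟨hfg, ht, hμS, hlamS⟩ :=
    record_consequences_of_finite h23 hp2 hκ hγ Lf hLf hA S₀ hS₀ hSel hNP D hDt DS
  haveI := hfg
  have hμS' : muInvariant p DS.X = 0 := by rw [hμS]; exact hμ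
  -- `Sel^{Σ₀}[p]` is finite (`μ = 0`)
  haveI hfinT := finite_torsionBy_nonPrimitiveSelmerInfty_of_mu_eq_zero κ
    (↑S₀ : Set (HeightOneSpectrum (𝓞 ℚ))) DS ht hμS'
  -- GV Remark (2.7) ¶2: `S^{Σ₀}_A = Sel^{Σ₀}` is `p`-divisible
  have hC : ∀ (v : HeightOneSpectrum (𝓞 ℚ)) (hv : ((p : ℕ) : 𝓞 ℚ) ∈ v.asIdeal),
      (∀ c ∈ (Lf v hv).plus, ∃ c' ∈ (Lf v hv).plus, p • c' = c) ∧
        Nat.card ↥((Lf v hv).plus ⊓ (↥(W.geomPrimaryTorsion p))[(p : ℤ)]) = p :=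
    fun v hv ↦ ⟨fun c hc ↦ (hLf v hv).divisible hc,
      AdditivePotMult.RamifiedLineUnique.natCard_plus_inf_torsionBy_eq (hLf v hv)⟩
  have hfinD : Finite ↥(datumSelmerInfty κ (W.geomPrimaryTorsion p) Lf
        (↑S₀ : Set (HeightOneSpectrum (𝓞 ℚ))) ⊓
      (subgroupH1 κ.kerSubgroup (W.geomPrimaryTorsion p))[(p : ℤ)]) := by
    have hcard := natCard_torsionBy_eq_natCard_inf_torsionBy hNP p
    haveI : Nonempty ((nonPrimitiveSelmerInfty W κ (↑S₀ : Set (HeightOneSpectrum (𝓞 ℚ))))[(p : ℤ)]) :=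
      ⟨0⟩
    exact Nat.finite_of_card_ne_zero (by rw [← hcard]; exact Nat.card_pos.ne')
  have hdivD := hRQ W p hp2 κ hκ Lf hC
    (fun v hv m hm ↦ mem_plus_of_forall_inertia_smul_sub_mem (Lf v hv) (h0 v hv) m hm)
    S₀ hne hS₀ hS hfinD
  have hdiv : ∀ s : nonPrimitiveSelmerInfty W κ (↑S₀ : Set (HeightOneSpectrum (𝓞 ℚ))),
      ∃ t : nonPrimitiveSelmerInfty W κ (↑S₀ : Set (HeightOneSpectrum (𝓞 ℚ))), p • t = s := by
    intro s
    have hs : (s : subgroupH1 κ.kerSubgroup (W.geomPrimaryTorsion p)) ∈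
        datumSelmerInfty κ (W.geomPrimaryTorsion p) Lf (↑S₀ : Set (HeightOneSpectrum (𝓞 ℚ))) := by
      rw [← hNP]; exact s.2
    obtain ⟨t, ht, hts⟩ := hdivD _ hs
    rw [← hNP] at ht
    exact ⟨⟨t, ht⟩, Subtype.ext (by rw [AddSubgroupClass.coe_nsmul]; exact hts)⟩
  -- `#Sel^{Σ₀}[p] = p^{λ(X^{Σ₀})} = p^{λ(X) + Σδ}`
  obtain ⟨-, hcount⟩ :=
    X2.NonPrimitiveSelmerTorsionCard.finite_and_natCard_torsionBy_eq_pow_lambdaInvariant_of_divisible p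
      DS.X ht hμS' hdiv (toDualEquiv W κ _ DS)
  rw [hlamS, natCard_torsionBy_nonPrimitiveSelmerInfty_eq_of_greenbergKer_eq W p κ
    (↑S₀ : Set (HeightOneSpectrum (𝓞 ℚ))) hp2 hκ Lf hRD hS₀' hS'] at hcount
  -- GV Prop. (2.8) / Remark (2.9): `#S^{Σ₀}_{W[p]} = #(S^{Σ₀}_{W[p^∞]} ⊓ H¹[p]) · #W(ℚ_∞)[p]`
  haveI := hA
  have h28 := GreenbergVatsalTorsionRamified.natCard_gvSelmer_torsion_curve_of_invariants_eq_bot_of_finite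
    W p κ.kerSubgroup Lf (↑S₀ : Set (HeightOneSpectrum (𝓞 ℚ))) hS'
    (fun v hv ↦ fun c hc' ↦ (hLf v hv).divisible hc') h0
  obtain ⟨v₀, hv₀⟩ :=
    Literature.NumberTheory.NumberFields.RingOfIntegers.exists_heightOneSpectrum_natCast_mem ℚ hp.out
  rw [natCard_torsionBy_fixedPoints_eq_of_trivialLine (Lf v₀ hv₀) (hLf v₀ hv₀) (h0 v₀ hv₀) hΦ htriv]
    at h28
  -- display (16) at the datum
  obtain ⟨c, hcc⟩ := exists_isComplexConjugation (Rat.castHom ℝ)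
  have hdev := X3TwistedDatum.natCard_gvSelmer_torsion_eq_mul_of_plus_eq_line hΦ hp2 heven Lf hplus
    (↑S₀ : Set (HeightOneSpectrum (𝓞 ℚ))) hS' κ.kerSubgroup
    (ResidualDevissageLine.mem_kerSubgroup_of_isComplexConjugation κ hcc) hcc hlift
  -- assembly
  change Nat.card (GreenbergVatsal2000.unramifiedOutside κ.kerSubgroup (lineSub Φ₀ hΦ).Sub p
      (↑S₀ : Set (HeightOneSpectrum (𝓞 ℚ)))) *
    Nat.card (ResidualDevissageSelmer.quotSelmer κ.kerSubgroup (lineSub Φ₀ hΦ).Quot p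
      (↑S₀ : Set (HeightOneSpectrum (𝓞 ℚ)))) = _
  rw [← hdev, h28]
  rw [gvSelmerInfty] at hcount
  rw [hcount, pow_succ]

end Generic

end Summit.BirchSwinnertonDyer.Rank1Residual.Additive

end
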